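import Literature.IUT.HodgeTheaters.PuncturedEllipticCoveringsModel
import HarnessLib

/-!
# [IUTchI] Remark 1.2.1: the predicate `Rmk121` on `PuncturedEllipticData` is a SCHEMA — universal-closure certificate
# (proof-only)

S. Mochizuki, *Inter-universal Teichmüller theory I*, kurims manuscript (May 2020), §1, Remark 1.2.1 p. 40
("`Aut_k(X→) = Gal(X→/C̲) (≅ ℤ/2lℤ)`, `Aut_k(C→) = Gal(C→/C̲) (≅ ℤ/lℤ)`") [claim: Mochizuki2012, status: disputed]
(IUTchI §1 Rmk 1.2.1, kurims p.40).  abc-iut cell, FACT-LIST row **F-2588** of layer L5 (seat abc-iut-w6-d089 gen 5, row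
«KL5-CLOSURE-CERTS-5»).  PROOF-ONLY companion of abc-iut-L5-t1's `PuncturedEllipticCoverings.lean` and of the L5 model file
`PuncturedEllipticCoveringsModel.lean` (no `def`, no `instance`, nothing re-typed).

The row was «LABEL-OPEN, HYPOTHESIS-CLASS»: conditional closers `rmk121` / `rmk121_of_card` (under `ArrowCoveringClaims`, the
printed claims of pp. 37–38) and the model witness `TrivialModel.rmk121` exist, a universal-closure decision did not.  The
GROUP-LEVEL rendering `Rmk121 D` asks, among other things, `[Π_C̲ : Π_{X→}] = 2l`; the interface `PuncturedEllipticData`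
leaves the representative decomposition group of the cusp `2ε` free subject only to `D_{2ε} ⊆ Π_X ∩ Π_C̲` and
`D_{2ε} ↠ G_k`.  Moving, in the tree's §1 model `toyDatum` (`Π_C = ℤ/10`, `G_k = 1`, `Π_X̲ = 2ℤ/10`), the decomposition
group of `2ε` from `1` to `Π_X̲` keeps every structure axiom but makes the construction of pp. 37–38 output
`Π_{X→} = D_{2ε} · jKer = Π_X̲`, of index `2 ≠ 2l = 10` in `Π_C̲`:

* `not_rmk121_of_relIndex_ne` — WHICH DEGENERATION KILLS THE CLAUSE: any datum with `[Π_C̲ : Π_{X→}] ≠ 2l` falsifies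
  `Rmk121` (so does it falsify `ArrowCoveringClaims.piXarrow_relindex`, `not_arrowCoveringClaims_of_relIndex_ne`);
* `exists_not_rmk121` — the modified toy datum; `not_forall_rmk121` — **F-2588 is a schema**: the universal closure is
  FALSE, while `toyDatum` satisfies it (`TrivialModel.rmk121`): `rmk121_schema`.  The content is `rmk121_of_card` under
  print's own claims `ArrowCoveringClaims`.

HONEST FRAMING: the witness exploits that OUR interface does not tie `D_{2ε}` to the section `σ : G_k → J_C` of p. 38 beyond
surjectivity onto `G_k` (vacuous at `G_k = 1`); in print `X→ → C̲` is a genuine cyclic covering of degree `2l`.  A refuted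
universal closure is a statement about our typing, not about Remark 1.2.1.  Nothing here bears on [IUTchIII] Cor. 3.12 or
takes a side; typed ≠ proved; refuted-as-typed ≠ refuted-in-print.
-/

namespace Literature.IUT.HodgeTheaters

namespace PuncturedEllipticData

open Topology

universe u

/-! ## Which degeneration kills the clause -/

/-- **IUTchI:Rmk1.2.1** (kurims p.40, group-level) fails for any datum whose `Π_{X→}` has index `≠ 2l` in `Π_C̲`.
[claim: Mochizuki2012, status: disputed] (IUTchI §1 Rmk 1.2.1, kurims p.40) -/
theorem not_rmk121_of_relIndex_ne (D : PuncturedEllipticData.{u}) (h : D.piXarrow.relIndex D.PiCbar ≠ 2 * D.l) :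
    ¬ D.Rmk121 := fun hr => h hr.card_galX

/-- The same degeneration falsifies the printed claims `ArrowCoveringClaims` of pp. 37–38 (their clause
`[Π_C̲ : Π_{X→}] = 2l`) — recorded for the consumers of `rmk121_of_card`. [claim: Mochizuki2012, status: disputed]
(IUTchI §1 p.38) -/
theorem not_arrowCoveringClaims_of_relIndex_ne (D : PuncturedEllipticData.{u})
    (h : D.piXarrow.relIndex D.PiCbar ≠ 2 * D.l) : ¬ D.ArrowCoveringClaims := fun ha => h ha.piXarrow_relindex

/-! ## The modified §1 model and the closed certificate -/

namespace TrivialModel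

/-- **An inhabitant falsifying Remark 1.2.1 as typed**: the §1 model `toyDatum` with the decomposition group of the
cusp `2ε` moved from `1` to `Π_X̲ = 2ℤ/10`; then `Π_{X→} = Π_X̲` has index `2 ≠ 10 = 2l` in `Π_C̲ = ℤ/10`.
[claim: Mochizuki2012, status: disputed] (IUTchI §1 Rmk 1.2.1, kurims p.40) -/
theorem exists_not_rmk121 : ∃ D : PuncturedEllipticData.{0}, ¬ D.Rmk121 ∧ ¬ D.ArrowCoveringClaims := by
  let dec : Cusp → Subgroup Amb := fun x => match x with
    | .e22 => PiXm
    | x => decomp x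
  let D : PuncturedEllipticData.{0} :=
    { toyDatum with
      decomp := dec
      decomp_le := by
        intro x
        cases x
        · exact bot_le
        · exact le_inf le_rfl le_top
        · exact le_inf le_rfl le_top
        · exact le_inf le_rfl le_top
      aug_decomp_twoε := fun _ => ⟨1, Subsingleton.elim _ _⟩ }
  have hmod : D.modLKer = ⊥ := modLKer_eq_bot
  have hinertia : ∀ x, D.inertia x = dec x := fun x => by
    show dec x ⊓ toyDatum.DeltaC = dec x
    rw [deltaC_eq_top, inf_top_eq]
  -- `Ker(Δ_X̲ ↠ Δ_ε)` now swallows `I_{2ε} = Π_X̲`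
  have hdek : D.deltaEpsKer = PiXm := by
    show D.modLKer ⊔ ⨆ x : {x : Cusp // D.IsNonzeroCusp x ∧ x ≠ Cusp.e1 ∧ x ≠ Cusp.e2}, D.inertia x.1 = PiXm
    rw [hmod, bot_sup_eq]
    apply le_antisymm
    · refine iSup_le fun x => ?_
      obtain ⟨x, hx0, hx1, hx2⟩ := x
      rw [hinertia]
      cases x <;> first | exact absurd rfl hx0 | exact absurd rfl hx1 | exact absurd rfl hx2 | exact le_rfl
    · exact le_iSup_of_le ⟨Cusp.e22, fun h => Cusp.noConfusion h, fun h => Cusp.noConfusion h,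
        fun h => Cusp.noConfusion h⟩ (by rw [hinertia])
  have hj : D.jKer = PiXm := by
    show D.deltaEpsKer ⊔ Subgroup.closure {z : Amb | ∃ x ∈ D.DeltaXbar,
      ∃ c ∈ D.DeltaCbar, c ∉ D.DeltaXbar ∧ z = x * c * x⁻¹ * c⁻¹} = PiXm
    rw [hdek]
    refine le_antisymm (sup_le le_rfl ?_) le_sup_left
    rw [Subgroup.closure_le]
    rintro _ ⟨x, -, c, -, -, rfl⟩
    rw [SetLike.mem_coe, mul_comm x c, mul_inv_cancel_right, mul_inv_cancel]
    exact one_mem _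
  have hpx : D.piXarrow = PiXm := by
    show dec Cusp.e22 ⊔ D.jKer = PiXm
    rw [hj]
    exact sup_idem _
  have hrel : D.piXarrow.relIndex D.PiCbar ≠ 2 * D.l := by
    rw [hpx, show D.PiCbar = ⊤ from rfl, Subgroup.relIndex_top_right, index_piXm]
    decide
  exact ⟨D, D.not_rmk121_of_relIndex_ne hrel, D.not_arrowCoveringClaims_of_relIndex_ne hrel⟩

/-- **F-2588 is a schema**: the universal closure of `PuncturedEllipticData.Rmk121` is FALSE (the modified toy datum),
while `toyDatum` satisfies it (`TrivialModel.rmk121`); the content is `rmk121_of_card` / `rmk121` under print's own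
`ArrowCoveringClaims`. [claim: Mochizuki2012, status: disputed] (IUTchI §1 Rmk 1.2.1, kurims p.40) -/
theorem not_forall_rmk121 : ¬ ∀ D : PuncturedEllipticData.{0}, D.Rmk121 := fun h => by
  obtain ⟨D, hD, -⟩ := exists_not_rmk121
  exact hD (h D)

/-- Likewise the universal closure of the printed-claims predicate `ArrowCoveringClaims` is FALSE (same datum), while
`toyDatum` satisfies it (`TrivialModel.arrowCoveringClaims`). [claim: Mochizuki2012, status: disputed] (IUTchI §1 p.38) -/
theorem not_forall_arrowCoveringClaims : ¬ ∀ D : PuncturedEllipticData.{0}, D.ArrowCoveringClaims := fun h => by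
  obtain ⟨D, -, hD⟩ := exists_not_rmk121
  exact hD (h D)

/-- The row is a SCHEMA (consistent ∧ independent). [claim: Mochizuki2012, status: disputed] (IUTchI §1 Rmk 1.2.1, kurims p.40) -/
theorem rmk121_schema :
    (∃ D : PuncturedEllipticData.{0}, D.Rmk121) ∧ ∃ D : PuncturedEllipticData.{0}, ¬ D.Rmk121 :=
  ⟨⟨toyDatum, rmk121⟩, let ⟨D, hD, _⟩ := exists_not_rmk121; ⟨D, hD⟩⟩

end TrivialModel

end PuncturedEllipticData

end Literature.IUT.HodgeTheaters
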